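import Summits.NavierStokesRegularity.NavierStokesRegularity.Theorems.SoloSalvageWu2026ConstructReduced3
import Summits.NavierStokesRegularity.NavierStokesRegularity.Theorems.SoloSalvageWu2026ConstructGradG1
import Summits.NavierStokesRegularity.NavierStokesRegularity.Theorems.SoloSalvageWu2026ConstructG2
import Summits.NavierStokesRegularity.NavierStokesRegularity.Theorems.SoloSalvageWu2026PressureCompact
import HarnessLib

/-!
# C177 `Wu2026` — TRUE column: `Step_construct` (§3.2–§3.4, the Euler blow-down tangent) HOLDS
# (D-0154 (2) INPUTS, cell `pub/ns-inputs`; assembled by seat `ns-in-wu-341` on the cut owner's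
# instruction 09:07Z from the pieces of seats `ns-in-wu-con` and `ns-in-wu-341`)

The binder `Literature.Claims.NS.Wu2026.Step_construct` of the claim skeleton (arXiv:2608.22471v1,
§3.2–§3.4 p.9–19): the structure `Tangent ν v p` is inhabited with the given good scales and
canonical pressure constant. Assembly of the cell's kernel objects:

* `step_construct_of_gradBounds : (G1) → (G2) → (B) → Step_construct` (wu-con,
  `SoloSalvageWu2026ConstructReduced3`: velocity compactness (A) from the all-scale local `L¹`
  gradient bound (G1), limit equations (C), inherited weak bounds (D), Sobolev bounds (E) from the
  good-scale local `L^{9/5}` gradient bound (G2));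
* `step_construct_gradBound_G1` (wu-con, `SoloSalvageWu2026ConstructGradG1`);
* `step_construct_G2` (this seat, `SoloSalvageWu2026ConstructG2`);
* `step_construct_pieceB` (this seat, `SoloSalvageWu2026PressureCompact`: pressure compactness (3.45)).

* `step_construct : Step_construct` — **the binder holds exactly as typed**; alias
  `Step_construct_holds`.

With `step_341` (p612959), `step_P33` (p615572, wu-p33) and `step_385` every binder of the
skeleton's composition is a kernel theorem; the named fact `Wu2026_thm11` follows
(`SoloSalvageWu2026Reduced3.wu2026_thm11_of_step_construct`) and item 0897 closes by the one-line
closer `SoloSalvageWu2026Closes0897`.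

WHAT THIS IS NOT: not a claim about NS regularity or blow-up — a printed step of a PREPRINT is
re-proved as typed; 0897 (`GaldiLiouvilleGate.CriticalRateLiouville`) is a route crux, not the
summit; not a claim about any author beyond the typed locator.
-/

noncomputable section

set_option linter.dupNamespace false

namespace Summit.NavierStokesRegularity.NavierStokesRegularity.Theorems.Wu2026Salvage

open Literature.Claims.NS.Wu2026

/-- **`Step_construct` holds** (§3.2–§3.4: the Euler blow-down tangent exists along the good
scales, with the canonical pressure constant): `step_construct_of_gradBounds` fed with
`step_construct_gradBound_G1`, `step_construct_G2`, `step_construct_pieceB`. [cite: Wu2026, §3.2–§3.4 p.9–19] -/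
theorem step_construct : Step_construct :=
  step_construct_of_gradBounds step_construct_gradBound_G1 step_construct_G2 step_construct_pieceB

/-- `_holds`-named alias of `step_construct` (D-0014 discharge convention for the named binder
`Literature.Claims.NS.Wu2026.Step_construct`). [cite: Wu2026, §3.2–§3.4 p.9–19] -/
theorem Step_construct_holds : Step_construct := step_construct

end Summit.NavierStokesRegularity.NavierStokesRegularity.Theorems.Wu2026Salvage

end

-- WHAT THIS IS NOT: not a claim about NS regularity or blow-up; not a claim about any author beyond the typed locator.
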